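import Summits.Ventures.PercRepro.S1CFCapsTools
import Summits.Ventures.PercRepro.S1CFSimpleCaps
import Summits.Ventures.PercRepro.S1CFGDouble

/-!
# PercRepro — THE CRUDE N-CAPS AT EVERY NULLITY `ν`: ALL LOW-RANK `k`-SET COUNTS (`k ≤ 5`) OF A LOOPLESS COLOOP-FREE
MATROID OF NULLITY `ν` ON `n ≥ 2ν + 1` POINTS FROM ONE BASE COUNT (p1, gen 38)

p7's nested dichotomy prices the regime ν of a cell `(13, d)` through the contraction `N = M ／ V` of nullity `k₀ = d − ν`;
at `d ≥ 10` the regime ν = 5 has `k₀ = 5` and `N` is NOT simple — the pricing script says «`k₀ = 5` — not priced». This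
module gives EVERY count `Q_k^s = #{X ⊆ E : |X| = k, rk X ≤ s}`, `k ≤ 5`, for a loopless coloop-free `N` of nullity `ν`
on `n ≥ 2ν + 1` points, from the one base count and the double count of S1CFGDouble:
* **`ncard_dep_pairs_le_choose`** — `D₂ = Q₂¹ ≤ C(ν, 2)` (the dependent pairs are relative circuits of the set `U` of
  partnered points, which is proper — `2 · rk E > n` — of nullity `≤ ν − 1`);
* **`three_mul_ncard_three_eRk_le_one_le`** `3 · Q₃¹ ≤ (ν − 2) · Q₂¹`, **`four_mul_ncard_four_eRk_le_one_le`**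
  `4 · Q₄¹ ≤ (ν − 3) · Q₃¹`, **`five_mul_ncard_five_eRk_le_one_le`** `5 · Q₅¹ ≤ (ν − 4) · Q₄¹` (no rank-`0` sets: loopless);
* **`ncard_three_eRk_le_two_le_split`** — `Q₃² ≤ (n − 2) · Q₂¹ + C(ν + 2, 3)` (a dependent pair or a triangle);
* **`four_mul_ncard_four_eRk_le_two_le`** — `4 · Q₄² ≤ (ν − 2) · Q₃² + (n − 3) · Q₃¹`;
* **`ncard_four_eRk_le_three_le_split`** — `Q₄³ ≤ C(n − 2, 2) · Q₂¹ + (n − 3) · C(ν + 2, 3) + C(ν + 3, 4)`;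
* **`five_mul_ncard_five_eRk_le_two_le`** — `5 · Q₅² ≤ (ν − 3) · Q₄² + (n − 4) · Q₄¹`;
* **`five_mul_ncard_five_eRk_le_four_le`** — `5 · Q₅⁴ ≤ (ν − 1) · C(n, 4) + (n − 4) · Q₄³` (with
  `five_mul_ncard_five_eRk_le_three_le` of S1CFGSimpleFive for `Q₅³`).
At `ν = 5`, `n = 13`: `D₂ ≤ 10`, `Q₃¹ ≤ 10`, `Q₄¹ ≤ 5`, `Q₅¹ ≤ 1`, `Q₃² ≤ 145`, `Q₄² ≤ 133`, `Q₄³ ≤ 970`, `Q₅² ≤ 62`,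
`Q₅³ ≤ 821` (S1CFGCrudeValues). These are the «kit-only» numbers of every regime; the sharp ones (nullity `4`: S1CFGValues;
simple nullity `5`: S1CFGSimpleFiveValues) are separate. Nothing about any cell is claimed. Axioms: standard.
-/

open scoped Matroid

namespace PercRepro

namespace S1CFG

open Set S1CF

variable {α : Type}

/-- A nonempty set of rank `0` contains a loop: in a loopless matroid no `k`-set (`k ≥ 1`) has rank `≤ 0`. -/
theorem ncard_eRk_le_zero_eq_zero (M : Matroid α) [M.Finite] (hL : ∀ e ∈ M.E, ¬ M.IsLoop e) {k : ℕ} (hk : 1 ≤ k) :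
    {X : Set α | X ⊆ M.E ∧ X.ncard = k ∧ M.eRk X ≤ ((0 : ℕ) : ℕ∞)}.ncard = 0 := by
  have hEfin := M.ground_finite
  rw [Set.ncard_eq_zero (hEfin.finite_subsets.subset (fun X hX => hX.1)), Set.eq_empty_iff_forall_notMem]
  rintro X ⟨hXE, hXk, hXr⟩
  have hXfin : X.Finite := hEfin.subset hXE
  obtain ⟨x, hx⟩ : X.Nonempty := by rw [← Set.ncard_pos hXfin, hXk]; omega
  have h0 : M.eRk X = 0 := le_antisymm (by simpa using hXr) bot_le
  rw [Matroid.eRk_eq_zero_iff hXE] at h0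
  exact hL x (hXE hx) (h0 hx)

/-- A `2`-set of rank `≤ 1` is dependent (the rank-`1` pairs are the dependent pairs). -/
theorem two_eRk_le_one_subset_dep (M : Matroid α) [M.Finite] :
    {X : Set α | X ⊆ M.E ∧ X.ncard = 2 ∧ M.eRk X ≤ 1} ⊆ {P : Set α | P ⊆ M.E ∧ P.ncard = 2 ∧ M.Dep P} := by
  intro X hX
  obtain ⟨hXE, hX2, hXr⟩ := hX
  refine ⟨hXE, hX2, ?_⟩
  have hXfin : X.Finite := M.ground_finite.subset hXE
  rw [← Matroid.eRk_lt_encard_iff_dep_of_finite hXfin hXE, ← hXfin.cast_ncard_eq, hX2]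
  exact lt_of_le_of_lt hXr (by norm_num)

/-- **`D₂ ≤ C(ν, 2)`** for a loopless coloop-free matroid of nullity `ν` on `n ≥ 2ν + 1` points. -/
theorem ncard_dep_pairs_le_choose (M : Matroid α) [M.Finite] (hL : ∀ e ∈ M.E, ¬ M.IsLoop e)
    (hK : ∀ e, ¬ M.IsColoop e) {ν : ℕ} (hd : M.E.encard = M.eRank + (ν : ℕ∞)) (hn : 2 * ν + 1 ≤ M.E.ncard) :
    {P : Set α | P ⊆ M.E ∧ P.ncard = 2 ∧ M.Dep P}.ncard ≤ ν.choose 2 := by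
  classical
  have hEfin := M.ground_finite
  -- the points with a partner
  set U := {u ∈ M.E | ∃ v ∈ M.E, v ≠ u ∧ M.Dep {u, v}} with hUdef
  have hUE : U ⊆ M.E := fun u hu => hu.1
  -- all dependent pairs are relative circuits of `U`
  have hpairs : {P : Set α | P ⊆ M.E ∧ P.ncard = 2 ∧ M.Dep P} ⊆
      {P : Set α | P ⊆ U ∧ P.ncard = 2 ∧ M.Dep (∅ ∪ P) ∧ ∀ Q, Q ⊂ P → M.Indep (∅ ∪ Q)} := by
    intro P hP
    obtain ⟨hPE, hP2, hPdep⟩ := hP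
    refine ⟨?_, hP2, by simpa using hPdep, fun Q hQ => by simpa using indep_of_ssubset_pair M hL hPE hP2 hQ⟩
    intro u huP
    refine ⟨hPE huP, ?_⟩
    obtain ⟨a, b, hab, rfl⟩ := Set.ncard_eq_two.1 hP2
    rcases huP with rfl | rfl
    · exact ⟨b, hPE (by simp), Ne.symm hab, hPdep⟩
    · exact ⟨a, hPE (by simp), hab, by rwa [Set.pair_comm]⟩
  -- `U` is covered by partners, so `U ≠ E`
  have hpartU : ∀ y ∈ U, ∃ z ∈ U, z ≠ y ∧ M.Dep {y, z} := by
    intro y hy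
    obtain ⟨v, hvE, hvy, hdep⟩ := hy.2
    exact ⟨v, ⟨hvE, y, hy.1, Ne.symm hvy, by rwa [Set.pair_comm]⟩, hvy, hdep⟩
  have hcover := two_mul_eRk_toNat_le_ncard_of_partner M hL U.ncard U hUE rfl hpartU
  have hUne : U ≠ M.E := by
    intro h
    have hrk := ncard_ground_eq_eRk_toNat_add M hd
    rw [h] at hcover
    omega
  have hUnull := ncard_add_one_le_eRk_toNat_add_of_ssubset M hd hK hUE hUne
  have hν : (∅ ∪ U).ncard ≤ (M.eRk (∅ ∪ U)).toNat + (ν - 1) := by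
    simpa using (by omega : U.ncard ≤ (M.eRk U).toNat + (ν - 1))
  have := (Set.ncard_le_ncard hpairs (relCircuits_finite M ∅ hUE 2)).trans
    (ncard_relCircuits_le M 2 (by norm_num) (ν - 1) ∅ U (empty_subset _) hUE
      (Set.disjoint_left.2 fun a ha => absurd ha (Set.notMem_empty a)) M.empty_indep hν)
  have hc : ν - 1 + 2 - 1 = ν := by omega
  rw [hc] at this
  exact this

/-- **`3 · Q₃¹ ≤ (ν − 2) · Q₂¹`** (loopless, coloop-free, nullity `ν`, `1 < rk E`). -/
theorem three_mul_ncard_three_eRk_le_one_le (M : Matroid α) [M.Finite] (hL : ∀ e ∈ M.E, ¬ M.IsLoop e)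
    (hK : ∀ e, ¬ M.IsColoop e) {ν : ℕ} (hd : M.E.encard = M.eRank + (ν : ℕ∞)) (hs : 1 < (M.eRk M.E).toNat) :
    3 * {X : Set α | X ⊆ M.E ∧ X.ncard = 3 ∧ M.eRk X ≤ 1}.ncard ≤
      (ν - 2) * {X : Set α | X ⊆ M.E ∧ X.ncard = 2 ∧ M.eRk X ≤ 1}.ncard := by
  have hEfin := M.ground_finite
  have hdc := mul_ncard_le_of_eRk M hK hd (k := 3) (s := 1) (by norm_num) (by norm_num) hs
  have h0 := ncard_eRk_le_zero_eq_zero M hL (k := 3 - 1) (by norm_num)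
  rw [show (1 : ℕ) - 1 = 0 by norm_num, h0, mul_zero, add_zero, show 1 + ν - 3 = ν - 2 by omega] at hdc
  have hex : {Y : Set α | Y ⊆ M.E ∧ Y.ncard = 3 - 1 ∧ M.eRk Y = 1}.ncard ≤
      {X : Set α | X ⊆ M.E ∧ X.ncard = 2 ∧ M.eRk X ≤ 1}.ncard := by
    refine Set.ncard_le_ncard ?_ (hEfin.finite_subsets.subset (fun X hX => hX.1))
    intro Y hY
    exact ⟨hY.1, by simpa using hY.2.1, le_of_eq hY.2.2⟩
  exact hdc.trans (Nat.mul_le_mul_left _ hex)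

/-- **`4 · Q₄¹ ≤ (ν − 3) · Q₃¹`** (loopless, coloop-free, nullity `ν`, `1 < rk E`). -/
theorem four_mul_ncard_four_eRk_le_one_le (M : Matroid α) [M.Finite] (hL : ∀ e ∈ M.E, ¬ M.IsLoop e)
    (hK : ∀ e, ¬ M.IsColoop e) {ν : ℕ} (hd : M.E.encard = M.eRank + (ν : ℕ∞)) (hs : 1 < (M.eRk M.E).toNat) :
    4 * {X : Set α | X ⊆ M.E ∧ X.ncard = 4 ∧ M.eRk X ≤ 1}.ncard ≤
      (ν - 3) * {X : Set α | X ⊆ M.E ∧ X.ncard = 3 ∧ M.eRk X ≤ 1}.ncard := by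
  have hEfin := M.ground_finite
  have hdc := mul_ncard_le_of_eRk M hK hd (k := 4) (s := 1) (by norm_num) (by norm_num) hs
  have h0 := ncard_eRk_le_zero_eq_zero M hL (k := 4 - 1) (by norm_num)
  rw [show (1 : ℕ) - 1 = 0 by norm_num, h0, mul_zero, add_zero, show 1 + ν - 4 = ν - 3 by omega] at hdc
  have hex : {Y : Set α | Y ⊆ M.E ∧ Y.ncard = 4 - 1 ∧ M.eRk Y = 1}.ncard ≤
      {X : Set α | X ⊆ M.E ∧ X.ncard = 3 ∧ M.eRk X ≤ 1}.ncard := by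
    refine Set.ncard_le_ncard ?_ (hEfin.finite_subsets.subset (fun X hX => hX.1))
    intro Y hY
    exact ⟨hY.1, by simpa using hY.2.1, le_of_eq hY.2.2⟩
  exact hdc.trans (Nat.mul_le_mul_left _ hex)

/-- **`5 · Q₅¹ ≤ (ν − 4) · Q₄¹`** (loopless, coloop-free, nullity `ν`, `1 < rk E`). -/
theorem five_mul_ncard_five_eRk_le_one_le (M : Matroid α) [M.Finite] (hL : ∀ e ∈ M.E, ¬ M.IsLoop e)
    (hK : ∀ e, ¬ M.IsColoop e) {ν : ℕ} (hd : M.E.encard = M.eRank + (ν : ℕ∞)) (hs : 1 < (M.eRk M.E).toNat) :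
    5 * {X : Set α | X ⊆ M.E ∧ X.ncard = 5 ∧ M.eRk X ≤ 1}.ncard ≤
      (ν - 4) * {X : Set α | X ⊆ M.E ∧ X.ncard = 4 ∧ M.eRk X ≤ 1}.ncard := by
  have hEfin := M.ground_finite
  have hdc := mul_ncard_le_of_eRk M hK hd (k := 5) (s := 1) (by norm_num) (by norm_num) hs
  have h0 := ncard_eRk_le_zero_eq_zero M hL (k := 5 - 1) (by norm_num)
  rw [show (1 : ℕ) - 1 = 0 by norm_num, h0, mul_zero, add_zero, show 1 + ν - 5 = ν - 4 by omega] at hdc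
  have hex : {Y : Set α | Y ⊆ M.E ∧ Y.ncard = 5 - 1 ∧ M.eRk Y = 1}.ncard ≤
      {X : Set α | X ⊆ M.E ∧ X.ncard = 4 ∧ M.eRk X ≤ 1}.ncard := by
    refine Set.ncard_le_ncard ?_ (hEfin.finite_subsets.subset (fun X hX => hX.1))
    intro Y hY
    exact ⟨hY.1, by simpa using hY.2.1, le_of_eq hY.2.2⟩
  exact hdc.trans (Nat.mul_le_mul_left _ hex)

/-- **`Q₃² ≤ (n − 2) · D₂ + C(ν + 2, 3)`**: a `3`-set of rank `≤ 2` contains a dependent pair or is a triangle. -/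
theorem ncard_three_eRk_le_two_le_split (M : Matroid α) [M.Finite] {ν : ℕ}
    (hd : M.E.encard = M.eRank + (ν : ℕ∞)) :
    {X : Set α | X ⊆ M.E ∧ X.ncard = 3 ∧ M.eRk X ≤ 2}.ncard ≤
      (M.E.ncard - 2) * {P : Set α | P ⊆ M.E ∧ P.ncard = 2 ∧ M.Dep P}.ncard + (ν + 2).choose 3 := by
  classical
  have hEfin := M.ground_finite
  set A := {X : Set α | X ⊆ M.E ∧ X.ncard = 3 ∧ ∃ P ⊆ X, P.ncard = 2 ∧ M.Dep P} with hA
  set T := {C : Set α | C ⊆ M.E ∧ M.IsCircuit C ∧ C.ncard = 3} with hT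
  have hAfin : A.Finite := hEfin.finite_subsets.subset (fun X hX => hX.1)
  have hTfin : T.Finite := hEfin.finite_subsets.subset (fun X hX => hX.1)
  have hsplit : {X : Set α | X ⊆ M.E ∧ X.ncard = 3 ∧ M.eRk X ≤ 2} ⊆ A ∪ T := by
    intro X hX
    obtain ⟨hXE, hX3, hXr⟩ := hX
    have hXfin : X.Finite := hEfin.subset hXE
    have hXdep : M.Dep X := by
      rw [← Matroid.eRk_lt_encard_iff_dep_of_finite hXfin hXE, ← hXfin.cast_ncard_eq, hX3]
      exact lt_of_le_of_lt hXr (by norm_num)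
    by_cases h : ∃ P ⊆ X, P.ncard = 2 ∧ M.Dep P
    · exact Or.inl ⟨hXE, hX3, h⟩
    · push Not at h
      exact Or.inr ⟨hXE, isCircuit_of_dep_three_of_no_dep_pair M hXE hX3 hXdep h, hX3⟩
  have hAle : A.ncard ≤ (M.E.ncard - 2) * {P : Set α | P ⊆ M.E ∧ P.ncard = 2 ∧ M.Dep P}.ncard := by
    have := ncard_with_dep_pair_le M 3
    rw [show (3 : ℕ) - 2 = 1 by norm_num, Nat.choose_one_right] at this
    exact this
  have hTle : T.ncard ≤ (ν + 2).choose 3 := by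
    have hc := ncard_isCircuit_ncard_eq_le M (ν := ν) (k := 3) (by norm_num) (subset_refl M.E)
      (ncard_ground_eq_eRk_toNat_add M hd).le
    rw [show ν + 3 - 1 = ν + 2 by omega] at hc
    exact hc
  calc {X : Set α | X ⊆ M.E ∧ X.ncard = 3 ∧ M.eRk X ≤ 2}.ncard
      ≤ (A ∪ T).ncard := Set.ncard_le_ncard hsplit (hAfin.union hTfin)
    _ ≤ A.ncard + T.ncard := Set.ncard_union_le _ _
    _ ≤ _ := add_le_add hAle hTle

/-- **`4 · Q₄² ≤ (ν − 2) · Q₃² + (n − 3) · Q₃¹`** (coloop-free, nullity `ν`, `2 < rk E`). -/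
theorem four_mul_ncard_four_eRk_le_two_le (M : Matroid α) [M.Finite] (hK : ∀ e, ¬ M.IsColoop e) {ν : ℕ}
    (hd : M.E.encard = M.eRank + (ν : ℕ∞)) (hs : 2 < (M.eRk M.E).toNat) :
    4 * {X : Set α | X ⊆ M.E ∧ X.ncard = 4 ∧ M.eRk X ≤ 2}.ncard ≤
      (ν - 2) * {X : Set α | X ⊆ M.E ∧ X.ncard = 3 ∧ M.eRk X ≤ 2}.ncard +
        (M.E.ncard - 3) * {X : Set α | X ⊆ M.E ∧ X.ncard = 3 ∧ M.eRk X ≤ 1}.ncard := by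
  have hEfin := M.ground_finite
  have hdc := mul_ncard_le_of_eRk M hK hd (k := 4) (s := 2) (by norm_num) (by norm_num) hs
  have hex : {Y : Set α | Y ⊆ M.E ∧ Y.ncard = 4 - 1 ∧ M.eRk Y = 2}.ncard ≤
      {X : Set α | X ⊆ M.E ∧ X.ncard = 3 ∧ M.eRk X ≤ 2}.ncard := by
    refine Set.ncard_le_ncard ?_ (hEfin.finite_subsets.subset (fun X hX => hX.1))
    intro Y hY
    exact ⟨hY.1, by simpa using hY.2.1, le_of_eq hY.2.2⟩
  have hlow : {Y : Set α | Y ⊆ M.E ∧ Y.ncard = 4 - 1 ∧ M.eRk Y ≤ ((2 - 1 : ℕ) : ℕ∞)}.ncard =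
      {X : Set α | X ⊆ M.E ∧ X.ncard = 3 ∧ M.eRk X ≤ 1}.ncard := by
    congr 1
  rw [hlow, show 2 + ν - 4 = ν - 2 by omega] at hdc
  rw [show (4 : ℕ) - 1 = 3 by norm_num] at hdc hex
  exact hdc.trans (Nat.add_le_add_right (Nat.mul_le_mul_left _ hex) _)

/-- **`Q₄³ ≤ C(n − 2, 2) · D₂ + (n − 3) · C(ν + 2, 3) + C(ν + 3, 4)`** (the general split with the circuit counts). -/
theorem ncard_four_eRk_le_three_le_split (M : Matroid α) [M.Finite] {ν : ℕ}
    (hd : M.E.encard = M.eRank + (ν : ℕ∞)) :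
    {X : Set α | X ⊆ M.E ∧ X.ncard = 4 ∧ M.eRk X ≤ 3}.ncard ≤
      (M.E.ncard - 2).choose 2 * {P : Set α | P ⊆ M.E ∧ P.ncard = 2 ∧ M.Dep P}.ncard +
        (M.E.ncard - 3) * (ν + 2).choose 3 + (ν + 3).choose 4 := by
  have hEfin := M.ground_finite
  have hs := ncard_dep_four_le_split_general M
  have hc3 := ncard_isCircuit_ncard_eq_le M (ν := ν) (k := 3) (by norm_num) (subset_refl M.E)
    (ncard_ground_eq_eRk_toNat_add M hd).le
  have hc4 := ncard_isCircuit_ncard_eq_le M (ν := ν) (k := 4) (by norm_num) (subset_refl M.E)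
    (ncard_ground_eq_eRk_toNat_add M hd).le
  rw [show ν + 3 - 1 = ν + 2 by omega] at hc3
  rw [show ν + 4 - 1 = ν + 3 by omega] at hc4
  have hc3' : (M.E.ncard - 3) * {C : Set α | C ⊆ M.E ∧ M.IsCircuit C ∧ C.ncard = 3}.ncard ≤
      (M.E.ncard - 3) * (ν + 2).choose 3 := Nat.mul_le_mul_left _ hc3
  have hsub := Set.ncard_le_ncard (four_eRk_le_three_subset_dep M)
    (hEfin.finite_subsets.subset (fun X hX => hX.1))
  omega

/-- **`5 · Q₅² ≤ (ν − 3) · Q₄² + (n − 4) · Q₄¹`** (coloop-free, nullity `ν`, `2 < rk E`). -/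
theorem five_mul_ncard_five_eRk_le_two_le (M : Matroid α) [M.Finite] (hK : ∀ e, ¬ M.IsColoop e) {ν : ℕ}
    (hd : M.E.encard = M.eRank + (ν : ℕ∞)) (hs : 2 < (M.eRk M.E).toNat) :
    5 * {X : Set α | X ⊆ M.E ∧ X.ncard = 5 ∧ M.eRk X ≤ 2}.ncard ≤
      (ν - 3) * {X : Set α | X ⊆ M.E ∧ X.ncard = 4 ∧ M.eRk X ≤ 2}.ncard +
        (M.E.ncard - 4) * {X : Set α | X ⊆ M.E ∧ X.ncard = 4 ∧ M.eRk X ≤ 1}.ncard := by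
  have hEfin := M.ground_finite
  have hdc := mul_ncard_le_of_eRk M hK hd (k := 5) (s := 2) (by norm_num) (by norm_num) hs
  have hex : {Y : Set α | Y ⊆ M.E ∧ Y.ncard = 5 - 1 ∧ M.eRk Y = 2}.ncard ≤
      {X : Set α | X ⊆ M.E ∧ X.ncard = 4 ∧ M.eRk X ≤ 2}.ncard := by
    refine Set.ncard_le_ncard ?_ (hEfin.finite_subsets.subset (fun X hX => hX.1))
    intro Y hY
    exact ⟨hY.1, by simpa using hY.2.1, le_of_eq hY.2.2⟩
  have hlow : {Y : Set α | Y ⊆ M.E ∧ Y.ncard = 5 - 1 ∧ M.eRk Y ≤ ((2 - 1 : ℕ) : ℕ∞)}.ncard =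
      {X : Set α | X ⊆ M.E ∧ X.ncard = 4 ∧ M.eRk X ≤ 1}.ncard := by
    congr 1
  rw [hlow, show 2 + ν - 5 = ν - 3 by omega] at hdc
  rw [show (5 : ℕ) - 1 = 4 by norm_num] at hdc hex
  exact hdc.trans (Nat.add_le_add_right (Nat.mul_le_mul_left _ hex) _)

/-- **`5 · Q₅⁴ ≤ (ν − 1) · C(n, 4) + (n − 4) · Q₄³`** (coloop-free, nullity `ν`, `4 < rk E`): the dependent `5`-sets. -/
theorem five_mul_ncard_five_eRk_le_four_le (M : Matroid α) [M.Finite] (hK : ∀ e, ¬ M.IsColoop e) {ν : ℕ}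
    (hd : M.E.encard = M.eRank + (ν : ℕ∞)) (hs : 4 < (M.eRk M.E).toNat) :
    5 * {X : Set α | X ⊆ M.E ∧ X.ncard = 5 ∧ M.eRk X ≤ 4}.ncard ≤
      (ν - 1) * M.E.ncard.choose 4 +
        (M.E.ncard - 4) * {X : Set α | X ⊆ M.E ∧ X.ncard = 4 ∧ M.eRk X ≤ 3}.ncard := by
  have hEfin := M.ground_finite
  have hdc := mul_ncard_le_of_eRk M hK hd (k := 5) (s := 4) (by norm_num) (by norm_num) hs
  have hex : {Y : Set α | Y ⊆ M.E ∧ Y.ncard = 5 - 1 ∧ M.eRk Y = 4}.ncard ≤ M.E.ncard.choose 4 := by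
    rw [← ncard_subsets_eq_choose hEfin 4]
    refine Set.ncard_le_ncard ?_ (hEfin.finite_subsets.subset (fun X hX => hX.1))
    intro Y hY
    exact ⟨hY.1, by simpa using hY.2.1⟩
  have hlow : {Y : Set α | Y ⊆ M.E ∧ Y.ncard = 5 - 1 ∧ M.eRk Y ≤ ((4 - 1 : ℕ) : ℕ∞)}.ncard =
      {X : Set α | X ⊆ M.E ∧ X.ncard = 4 ∧ M.eRk X ≤ 3}.ncard := by
    congr 1
  rw [hlow, show 4 + ν - 5 = ν - 1 by omega] at hdc
  rw [show (5 : ℕ) - 1 = 4 by norm_num] at hdc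
  exact hdc.trans (Nat.add_le_add_right (Nat.mul_le_mul_left _ hex) _)

end S1CFG

end PercRepro
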